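import Mathlib.Algebra.BigOperators.Associated
import Mathlib.Algebra.Order.Chebyshev
import Literature.NumberTheory.LFunctions.DirichletPolynomialDiscreteMeanValue
import HarnessLib

/-!
# Moments of prime Dirichlet polynomials at well-spaced points (Balazard–de Roton 2008, Prop. 13)

Topic `Literature/NumberTheory/LFunctions`. Everything in this file is PROVED (no definitions of
notions beyond local abbreviations, no named facts).

M. Balazard, A. de Roton, arXiv:0810.3587, Prop. 13 (= H. Maier, H. L. Montgomery, *The sum of the
Möbius function*, Bull. LMS 41 (2009), Lemma 5; K. Soundararajan 2009, Lemma 3):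

> Soit `P(s) = Σ_{p ≤ N} a(p) p^{-s}` (`p` premier), `s_1, …, s_R` avec `1 ≤ |Im(s_i − s_j)| ≤ T`
> (`i ≠ j`), `Re s_i ≥ α`, `T ≥ 3`. Alors pour tout entier `k ≥ 1` avec `N^k ≤ T`,
> `Σ_r |P(s_r)|^{2k} ≪ T (log T)² k! (Σ_{p ≤ N} |a(p)|² p^{-2α})^k`.

We prove the case of points on one vertical line `s_r = α + it_r` (the case used in Prop. 17 and,
with `α = 1/2`, in Prop. 20), with the explicit constant `288 T log(2T)` in place of `T (log T)²`:
`Literature.NumberTheory.LFunctions.sum_norm_primePoly_pow_le`. Proof (as printed): `P^k` is a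
Dirichlet polynomial of length `N^k ≤ T` whose coefficients `b(n) = Σ_{p_1⋯p_k = n} Π a(p_i)`
satisfy `Σ |b(n)|² ≤ k! (Σ |a(p)|²)^k` (every `n` has at most `k!` ordered representations,
`PrimePolyMoments.card_fiber_le_factorial`, and Cauchy–Schwarz), and the discrete mean value
theorem of the tree (`Literature.NumberTheory.LFunctions.sum_norm_sq_dirichletPoly_le`, Ivić Thm 5.3).

## References

* [BalazardDeRoton2008] M. Balazard, A. de Roton, arXiv:0810.3587, Prop. 13. [cite: BalazardDeRoton2008, Prop. 13]
* H. Maier, H. L. Montgomery, Bull. London Math. Soc. 41 (2009), 213–226, Lemma 5.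
* A. Ivić, *The Riemann zeta-function* (1985), Thm 5.3.
-/

noncomputable section

open Complex Finset Fintype

namespace Literature.NumberTheory.LFunctions

namespace PrimePolyMoments

variable (S : Finset ℕ) (k : ℕ)

/-- The ordered `k`-tuples from `S` with product `n`. [folklore] -/
def fiber (n : ℕ) : Finset (Fin k → ℕ) :=
  (piFinset fun _ : Fin k ↦ S).filter fun f ↦ ∏ i, f i = n

variable {S k}

/-- Membership in `fiber`. [folklore] -/
theorem mem_fiber {n : ℕ} {f : Fin k → ℕ} : f ∈ fiber S k n ↔ (∀ i, f i ∈ S) ∧ ∏ i, f i = n := by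
  simp [fiber, mem_piFinset]

/-- **Every `n` has at most `k!` ordered representations as a product of `k` primes from `S`.**
[folklore] -/
theorem card_fiber_le_factorial (hS : ∀ p ∈ S, p.Prime) : ∀ (k n : ℕ), (fiber S k n).card ≤ k.factorial := by
  classical
  intro k
  induction k with
  | zero =>
    intro n
    rw [Nat.factorial_zero]
    exact Finset.card_le_one.2 fun f _ g _ ↦ funext fun i ↦ Fin.elim0 i
  | succ k ih =>
    intro n
    rcases (fiber S (k + 1) n).eq_empty_or_nonempty with h0 | ⟨f₀, hf₀⟩
    · rw [h0, Finset.card_empty]; exact Nat.zero_le _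
    rw [mem_fiber] at hf₀
    -- every `f` in the fiber: `f 0 ∈ image f₀ univ` and `tail f ∈ fiber k (n / f 0)`
    set F : ℕ → Finset (Fin (k + 1) → ℕ) := fun p ↦
      (fiber S k (n / p)).image (fun g : Fin k → ℕ ↦ (Matrix.vecCons p g : Fin (k + 1) → ℕ)) with hF
    have hsub : fiber S (k + 1) n ⊆ (Finset.univ.image f₀).biUnion F := by
      intro f hf
      rw [mem_fiber] at hf
      rw [Finset.mem_biUnion]
      have hp : (f 0).Prime := hS _ (hf.1 0)
      have hdvd : f 0 ∣ ∏ i, f₀ i := by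
        rw [hf₀.2, ← hf.2, Fin.prod_univ_succ]; exact dvd_mul_right _ _
      obtain ⟨j, _, hj⟩ := Prime.exists_mem_finset_dvd hp.prime hdvd
      have hj' : f 0 = f₀ j := (Nat.prime_dvd_prime_iff_eq hp (hS _ (hf₀.1 j))).1 hj
      refine ⟨f 0, Finset.mem_image.2 ⟨j, Finset.mem_univ _, hj'.symm⟩, ?_⟩
      rw [hF, Finset.mem_image]
      refine ⟨Matrix.vecTail f, ?_, Matrix.cons_head_tail f⟩
      rw [mem_fiber]
      refine ⟨fun i ↦ hf.1 _, ?_⟩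
      have hprod : f 0 * ∏ i, Matrix.vecTail f i = n := by
        rw [← hf.2, Fin.prod_univ_succ]; rfl
      rw [← hprod, Nat.mul_div_cancel_left _ hp.pos]
    calc (fiber S (k + 1) n).card
        ≤ ((Finset.univ.image f₀).biUnion F).card := Finset.card_le_card hsub
      _ ≤ ∑ p ∈ Finset.univ.image f₀, (F p).card := Finset.card_biUnion_le
      _ ≤ ∑ _p ∈ Finset.univ.image f₀, k.factorial :=
          Finset.sum_le_sum fun p _ ↦ Finset.card_image_le.trans (ih _)
      _ = (Finset.univ.image f₀).card * k.factorial := by rw [Finset.sum_const, smul_eq_mul]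
      _ ≤ (k + 1) * k.factorial := by
          gcongr
          exact Finset.card_image_le.trans (by simp)
      _ = (k + 1).factorial := (Nat.factorial_succ k).symm

/-- The coefficients of `P^k`: `b(n) = Σ_{f ∈ fiber n} Π_i a(f i)`. [cite: BalazardDeRoton2008, Prop. 13 (proof)] -/
def powCoeff (S : Finset ℕ) (a : ℕ → ℂ) (k n : ℕ) : ℂ := ∑ f ∈ fiber S k n, ∏ i, a (f i)

/-- `n ↦ (n : ℂ)^w` is multiplicative on `ℕ`. [folklore] -/
def cpowHom (w : ℂ) : ℕ →* ℂ where
  toFun n := (n : ℂ) ^ w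
  map_one' := by simp
  map_mul' m n := by push_cast; exact natCast_mul_natCast_cpow m n w

/-- Unfolding `cpowHom`. [folklore] -/
@[simp] theorem cpowHom_apply (w : ℂ) (n : ℕ) : cpowHom w n = (n : ℂ) ^ w := rfl

/-- Products of `k` elements of `S ⊆ [1, N]` lie in `[1, N^k]`. [folklore] -/
theorem prod_mem_Icc {N : ℕ} (hS1 : ∀ p ∈ S, 1 ≤ p) (hSN : ∀ p ∈ S, p ≤ N) {f : Fin k → ℕ}
    (hf : ∀ i, f i ∈ S) : ∏ i, f i ∈ Finset.Icc 1 (N ^ k) := by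
  rw [Finset.mem_Icc]
  constructor
  · rw [show (1 : ℕ) = ∏ _i : Fin k, 1 by simp]
    exact Finset.prod_le_prod' fun i _ ↦ hS1 _ (hf i)
  · rw [show N ^ k = ∏ _i : Fin k, N by simp]
    exact Finset.prod_le_prod' fun i _ ↦ hSN _ (hf i)

/-- **Expansion of `P(s)^k` as a Dirichlet polynomial of length `N^k`.** [folklore] -/
theorem primePoly_pow_eq {N : ℕ} (hS1 : ∀ p ∈ S, 1 ≤ p) (hSN : ∀ p ∈ S, p ≤ N) (a : ℕ → ℂ) (w : ℂ) :
    (∑ p ∈ S, a p * (p : ℂ) ^ w) ^ k =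
      ∑ n ∈ Finset.Icc 1 (N ^ k), powCoeff S a k n * (n : ℂ) ^ w := by
  classical
  rw [Finset.sum_pow']
  -- each tuple term: `Π (a(f i) (f i)^w) = (Π a(f i)) · (Π f i)^w`
  have hterm : ∀ f ∈ piFinset fun _ : Fin k ↦ S,
      ∏ i, (a (f i) * ((f i : ℕ) : ℂ) ^ w) = (∏ i, a (f i)) * ((∏ i, f i : ℕ) : ℂ) ^ w := by
    intro f _
    rw [Finset.prod_mul_distrib]
    congr 1
    have := map_prod (cpowHom w) f Finset.univ
    simp only [cpowHom_apply] at this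
    exact this.symm
  rw [Finset.sum_congr rfl hterm, ← Finset.sum_fiberwise_of_maps_to (g := fun f : Fin k → ℕ ↦ ∏ i, f i)
    (t := Finset.Icc 1 (N ^ k)) (fun f hf ↦ prod_mem_Icc hS1 hSN (mem_piFinset.1 hf))]
  refine Finset.sum_congr rfl fun n _ ↦ ?_
  rw [powCoeff, Finset.sum_mul]
  unfold fiber
  refine Finset.sum_congr rfl fun f hf ↦ ?_
  rw [Finset.mem_filter] at hf
  rw [hf.2]

/-- **`Σ_n |b(n)|² ≤ k! (Σ_p |a(p)|²)^k`** for the coefficients `b = powCoeff` of `P^k`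
(Cauchy–Schwarz on each fiber, of size `≤ k!`). [cite: BalazardDeRoton2008, Prop. 13 (proof)] -/
theorem sum_norm_sq_powCoeff_le {N : ℕ} (hS : ∀ p ∈ S, p.Prime) (hSN : ∀ p ∈ S, p ≤ N) (a : ℕ → ℂ) :
    ∑ n ∈ Finset.Icc 1 (N ^ k), ‖powCoeff S a k n‖ ^ 2 ≤
      k.factorial * (∑ p ∈ S, ‖a p‖ ^ 2) ^ k := by
  classical
  have hS1 : ∀ p ∈ S, 1 ≤ p := fun p hp ↦ (hS p hp).one_lt.le
  -- pointwise Cauchy–Schwarz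
  have hpt : ∀ n, ‖powCoeff S a k n‖ ^ 2 ≤ k.factorial * ∑ f ∈ fiber S k n, ‖∏ i, a (f i)‖ ^ 2 := by
    intro n
    calc ‖powCoeff S a k n‖ ^ 2 ≤ (∑ f ∈ fiber S k n, ‖∏ i, a (f i)‖) ^ 2 := by
          rw [powCoeff]; gcongr; exact norm_sum_le _ _
      _ ≤ (fiber S k n).card * ∑ f ∈ fiber S k n, ‖∏ i, a (f i)‖ ^ 2 := sq_sum_le_card_mul_sum_sq
      _ ≤ k.factorial * ∑ f ∈ fiber S k n, ‖∏ i, a (f i)‖ ^ 2 := by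
          gcongr
          exact_mod_cast card_fiber_le_factorial hS k n
  calc ∑ n ∈ Finset.Icc 1 (N ^ k), ‖powCoeff S a k n‖ ^ 2
      ≤ ∑ n ∈ Finset.Icc 1 (N ^ k), (k.factorial * ∑ f ∈ fiber S k n, ‖∏ i, a (f i)‖ ^ 2) :=
        Finset.sum_le_sum fun n _ ↦ hpt n
    _ = k.factorial * ∑ n ∈ Finset.Icc 1 (N ^ k), ∑ f ∈ fiber S k n, ‖∏ i, a (f i)‖ ^ 2 := by
        rw [Finset.mul_sum]
    _ = k.factorial * ∑ f ∈ piFinset (fun _ : Fin k ↦ S), ‖∏ i, a (f i)‖ ^ 2 := by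
        congr 1
        unfold fiber
        exact Finset.sum_fiberwise_of_maps_to (g := fun f : Fin k → ℕ ↦ ∏ i, f i)
          (fun f hf ↦ prod_mem_Icc hS1 hSN (mem_piFinset.1 hf)) _
    _ = k.factorial * (∑ p ∈ S, ‖a p‖ ^ 2) ^ k := by
        congr 1
        have : ∀ f : Fin k → ℕ, ‖∏ i, a (f i)‖ ^ 2 = ∏ i, ‖a (f i)‖ ^ 2 := fun f ↦ by
          rw [norm_prod, Finset.prod_pow]
        simp_rw [this]
        rw [Finset.sum_prod_piFinset S (fun (_ : Fin k) (p : ℕ) ↦ ‖a p‖ ^ 2), Finset.prod_const, Finset.card_univ,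
          Fintype.card_fin]

end PrimePolyMoments

open PrimePolyMoments in
/-- **Balazard–de Roton 2008, Prop. 13 (Maier–Montgomery, Lemma 5) on a vertical line.** Let `S` be
a finite set of primes `≤ N`, `a : ℕ → ℂ`, `k` a natural number with `N^k ≤ T`, `T ≥ 1`, and
`𝒯 ⊂ [−T, T]` a finite set of reals pairwise `≥ 1` apart. Then
`Σ_{t ∈ 𝒯} |Σ_{p ∈ S} a(p) p^{−it}|^{2k} ≤ 144 T log(2T) · k! (Σ_{p ∈ S} |a(p)|²)^k`.
(For points `α + it` take `a(p) p^{−α}` as coefficients.) [cite: BalazardDeRoton2008, Prop. 13] -/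
theorem sum_norm_primePoly_pow_le (S : Finset ℕ) (hS : ∀ p ∈ S, p.Prime) {N : ℕ} (hN : 1 ≤ N)
    (hSN : ∀ p ∈ S, p ≤ N) (a : ℕ → ℂ) (k : ℕ) {T : ℝ} (hT : 1 ≤ T) (hNT : ((N ^ k : ℕ) : ℝ) ≤ T)
    (𝒯 : Finset ℝ) (h𝒯 : ∀ t ∈ 𝒯, |t| ≤ T) (hsep : ∀ t ∈ 𝒯, ∀ t' ∈ 𝒯, t ≠ t' → 1 ≤ |t - t'|) :
    ∑ t ∈ 𝒯, ‖∑ p ∈ S, a p * (p : ℂ) ^ (-((t : ℂ) * I))‖ ^ (2 * k) ≤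
      144 * T * Real.log (2 * T) * (k.factorial * (∑ p ∈ S, ‖a p‖ ^ 2) ^ k) := by
  have hS1 : ∀ p ∈ S, 1 ≤ p := fun p hp ↦ (hS p hp).one_lt.le
  have hNk : 1 ≤ N ^ k := Nat.one_le_pow _ _ hN
  -- `|P(t)|^{2k} = |P(t)^k|² = |Σ b(n) n^{-it}|²`
  have hpow : ∀ t : ℝ, ‖∑ p ∈ S, a p * (p : ℂ) ^ (-((t : ℂ) * I))‖ ^ (2 * k) =
      ‖∑ n ∈ Finset.Icc 1 (N ^ k), powCoeff S a k n * (n : ℂ) ^ (-((t : ℂ) * I))‖ ^ 2 := by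
    intro t
    rw [← primePoly_pow_eq hS1 hSN a, norm_pow, ← pow_mul, mul_comm k 2]
  simp_rw [hpow]
  have hmvt := sum_norm_sq_dirichletPoly_le (N ^ k) (powCoeff S a k) T 𝒯 hNk hT h𝒯 hsep
  have hcoef := sum_norm_sq_powCoeff_le (k := k) hS hSN a
  have hNk' : (1 : ℝ) ≤ ((N ^ k : ℕ) : ℝ) := by exact_mod_cast hNk
  have hlog : Real.log (2 * ((N ^ k : ℕ) : ℝ)) ≤ Real.log (2 * T) :=
    Real.log_le_log (by positivity) (by linarith)
  have hlog0 : 0 ≤ Real.log (2 * ((N ^ k : ℕ) : ℝ)) := Real.log_nonneg (by linarith)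
  have hC0 : 0 ≤ (k.factorial : ℝ) * (∑ p ∈ S, ‖a p‖ ^ 2) ^ k := by positivity
  push_cast at hmvt hNT hNk' hlog hlog0 ⊢
  calc ∑ t ∈ 𝒯, ‖∑ n ∈ Finset.Icc 1 (N ^ k), powCoeff S a k n * (n : ℂ) ^ (-((t : ℂ) * I))‖ ^ 2
      ≤ 72 * (T + (N : ℝ) ^ k) * Real.log (2 * (N : ℝ) ^ k) *
          ∑ n ∈ Finset.Icc 1 (N ^ k), ‖powCoeff S a k n‖ ^ 2 := hmvt
    _ ≤ 72 * (T + T) * Real.log (2 * T) * ((k.factorial : ℝ) * (∑ p ∈ S, ‖a p‖ ^ 2) ^ k) := by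
        have hlogT : 0 ≤ Real.log (2 * T) := Real.log_nonneg (by linarith)
        gcongr
    _ = 144 * T * Real.log (2 * T) * (k.factorial * (∑ p ∈ S, ‖a p‖ ^ 2) ^ k) := by ring

end Literature.NumberTheory.LFunctions
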